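import Summits.RiemannHypothesis.RiemannHypothesis.Theses.OddSector
import Literature.NumberTheory.LFunctions.WeilOddGroundState
import Literature.NumberTheory.LFunctions.WeilSemilocalCompactnessProofs
import HarnessLib

/-!
# Odd-sector ground states exist at every window (helper for `OddSector.OddOneSignedWindows`)

Route `OddSector`, crux `OddOneSignedWindows` (item stmt-RiemannHypothesis-17778): the crux asks,
beyond every height `A`, for a window `a ≥ A` carrying an odd-sector ground state
`u` (`Literature.NumberTheory.LFunctions.IsWeilOddGroundState a u`, inlined token for token in the
route statement — `oddOneSignedWindows_iff`) that is real and `≥ 0` a.e. on `(0, a)`.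

This file supplies the EXISTENCE half, unconditionally and at EVERY window: for `a > 0` there is
an odd-sector ground state (`exists_isWeilOddGroundState`). It is Bombieri's Theorem 3 (2000, §4)
restricted to the odd sector, obtained here from the compactness of the form embedding
(Connes–Consani–Moscovici 2025 Thm. 3.6, PROVED in the tree as
`ConnesConsaniMoscovici2025_thm_3_6_holds`) applied to an odd minimising sequence
(`exists_weilOddMinimizingSeq`): a subsequence converges in `L²`, and a subsequence of an odd
minimising sequence is an odd minimising sequence.

What is NOT here: the sign of `u` on `(0, a)` (the content of the crux).
-/

noncomputable section

set_option linter.dupNamespace false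

open Complex Filter Set MeasureTheory
open scoped Topology

namespace Summit.RiemannHypothesis.RiemannHypothesis.Theorems.OddSector

open Literature.NumberTheory.LFunctions

/-- **Unfolding the crux.** `OddOneSignedWindows` is, definitionally, the statement "beyond every
height there is a window carrying an odd-sector ground state
(`Literature.NumberTheory.LFunctions.IsWeilOddGroundState`) which is real and nonnegative a.e. on
the right half-window". [folklore] -/
theorem oddOneSignedWindows_iff :
    Summit.RiemannHypothesis.RiemannHypothesis.Theses.OddSector.OddOneSignedWindows ↔
      ∀ A : ℝ, ∃ a : ℝ, A ≤ a ∧ ∃ u : ℝ → ℂ, IsWeilOddGroundState a u ∧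
        (∀ᵐ t : ℝ, t ∈ Ioo 0 a → (u t).im = 0 ∧ 0 ≤ (u t).re) :=
  Iff.rfl

/-- **Odd-sector ground states exist at every window** (Bombieri 2000, §4 Thm. 3, in the odd
sector): for every `a > 0` there is `u` with `IsWeilOddGroundState a u`. Proof: an `L²`-normalised
odd minimising sequence exists (`exists_weilOddMinimizingSeq`); its energies converge, hence are
bounded above; by the compactness of the form embedding
(`ConnesConsaniMoscovici2025_thm_3_6_holds`) a subsequence converges in `L²` to some `u ∈ L²`,
and that subsequence is still an odd normalised minimising sequence. -/
theorem exists_isWeilOddGroundState {a : ℝ} (ha : 0 < a) :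
    ∃ u : ℝ → ℂ, IsWeilOddGroundState a u := by
  obtain ⟨g, hg, hQ⟩ := exists_weilOddMinimizingSeq ha
  obtain ⟨u, hu, φ, hφ, hconv⟩ := ConnesConsaniMoscovici2025_thm_3_6_holds a ha g
    (fun n ↦ ⟨(hg n).1, (hg n).2.1, (hg n).2.2.2⟩) hQ.bddAbove_range
  exact ⟨u, IsWeilOddGroundState.of_tendsto hu (fun n ↦ hg (φ n)) (hQ.comp hφ.tendsto_atTop)
    hconv⟩

/-- **Odd-sector ground states exist beyond every height**: for every `A` there are `a ≥ A` and
`u` with `IsWeilOddGroundState a u` — the crux `OddOneSignedWindows` with its sign clause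
removed. (So the crux is exactly the assertion that, on an unbounded set of windows, one of these
ground states can be chosen real and one-signed on `(0, a)`.) [folklore] -/
theorem exists_isWeilOddGroundState_unbounded (A : ℝ) :
    ∃ a : ℝ, A ≤ a ∧ ∃ u : ℝ → ℂ, IsWeilOddGroundState a u := by
  obtain ⟨u, hu⟩ := exists_isWeilOddGroundState (lt_max_of_lt_right one_pos : (0 : ℝ) < max A 1)
  exact ⟨max A 1, le_max_left _ _, u, hu⟩

end Summit.RiemannHypothesis.RiemannHypothesis.Theorems.OddSector

end
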